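/-
Copyright (c) 2026 the pub-hodgecm-mathlib formalisation cell (harness21).  Prover seat hodgecm-mathlib-B-p14 (g32) — (R2) glue ∕ assembly heir and ROAD W owner,
2026-09-01.  ROAD W fold glue: the `√π ∕ √u` case split at a ramified place, WILD PLACES INCLUDED.
-/
import Literature.NumberTheory.Automorphic.RamifiedPlaceAntiFixedUniformizer   -- ★ F0P3a-p04 p843426: `valued_toPlace_uniformizer_of_ramified` (`|π_v|_w = exp(−2)`, `σ_w π_v = π_v`), the tame row
import HarnessLib

/-!
# The anti-fixed dichotomy at a ramified non-split place: `E_w = F_v(α)` with `σ_w α = −α` and `α` a UNIT or a UNIFORMISER (no tameness)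

Topic `NumberTheory/Automorphic`; namespace `Literature.NumberTheory.Automorphic.UnitaryGroup`.  KERNEL mathematics only: theorems, no definition, no named
fact, no instance, no notation, no `sorry`.  Cell `pub/hodgecm-mathlib`, crux H413 = `stmt-HodgeConjecture-24833`, line «N6nsGerm», stub `stub_N6nsR2EP :
RankOneEulerPoincareNonsplit`; ROAD W (the wild-ramified residue of (R2), F0P3a-p04 (g13) MEMO «R2EP-wild» (S4)): the action of `U(Φ₂)(E_w)` on the tree of
`SL₂(F_v)` has its two stabilisers `U ∩ GL₂(𝒪_w)`, `U ∩ D GL₂(𝒪_w) D⁻¹` in the roles (edge, vertex) or (vertex, edge) according as an anti-fixed generator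
`α` of `E_w ∕ F_v` can be taken to be a UNIFORMISER (`√π`-type: every tamely ramified place, and e.g. `ℚ₂(√2)`) or a UNIT (`√u`-type: wild only, e.g.
`ℚ₂(√−1)`, `ℚ₂(√3)`) — B-p08 (g28)'s two (W2) theorems are keyed on exactly this; THIS FILE supplies the case split at EVERY ramified non-split place.
HONEST LABEL: HC_CM is proved only modulo the cell's remaining named inputs (hLiu418, h413) until rung 0 closes; nothing printed is asserted here.

THE MATHEMATICS (`E ∕ F` quadratic, `c ∈ Aut(E∕F)`, `c ≠ 1`, `w ∣ v`, `c • w = w`, `σ_w := galAdicCompletionMap c hw`, `e(w|v) ≠ 1`; NO hypothesis on `2`).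
`σ_w ≠ id` (★ `exists_galAdicCompletionMap_ne`) gives `D := x − σ_w x ≠ 0` with `σ_w D = −D`; `P := ι_w(π_v)` is `σ_w`-fixed with `v_w(P) = exp(−2)` (★
`valued_toPlace_uniformizer_of_ramified`, `e = 2`); with `n := log v_w(D)` and `q := (n + 1) div 2`, **`α := D · P^{q}`** is anti-fixed with `v_w(α) = exp(n − 2q)
∈ {exp 0, exp(−1)}`.  (At a tame place the unit case is excluded by ★ `valued_lt_one_of_galAdicCompletionMap_eq_neg`; at a wild place both occur.)

* §1 `exists_units_galAdicCompletionMap_eq_neg_of_ramified` — `∃ α : E_wˣ, σ_w α = −α ∧ (v_w α = 1 ∨ v_w α = exp(−1))`.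
* §2 `exists_units_galAdicCompletionMap_complexConj_eq_neg_of_ramified` — the CM row (`F = L⁺`, `c` = complex conjugation).

## References
* [SerreLocalFields1979] J.-P. Serre, *Local Fields*, GTM 67 (1979), Ch. III §6, Ch. IV §§1–2 (`e = 2`; quadratic extensions `F(√a)`).
* [Jacobowitz1962] R. Jacobowitz, *Hermitian forms over local fields*, Amer. J. Math. 84 (1962), §5 (ramified non-dyadic: `π̄ = −π`), §§9–11 (ramified dyadic:
  the «R-U» ∕ «R-P» dichotomy `E = F(√u)` ∕ `F(√π)`).
-/

set_option autoImplicit false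

noncomputable section

open NumberField IsDedekindDomain
open scoped Valued

namespace Literature.NumberTheory.Automorphic.UnitaryGroup

open Literature.NumberTheory.Automorphic.Liu2021
open Literature.NumberTheory.GaloisRepresentations (HeckeCharacter)

variable {F : Type} (E : Type) [Field F] [NumberField F] [Field E] [NumberField E] [Algebra F E]
  [Algebra.IsQuadraticExtension F E] (c : E ≃ₐ[F] E) {v : HeightOneSpectrum (𝓞 F)}

/-! ## §1 An anti-fixed unit or an anti-fixed uniformiser -/

/-- **THE ANTI-FIXED DICHOTOMY at a ramified non-split place (tame or wild)**: there is `α ∈ E_wˣ` with `σ_w α = −α` which is either a UNIT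
(`v_w(α) = 1`, the `√u`-type) or a UNIFORMISER (`v_w(α) = exp(−1)`, the `√π`-type): normalise any non-zero anti-fixed `D = x − σ_w x` by the `σ_w`-fixed
`ι_w(π_v)^{q}`, `v_w(ι_w π_v) = exp(−2)`. [cite: SerreLocalFields1979, Ch. IV §§1–2] [cite: Jacobowitz1962, §5, §9] -/
theorem exists_units_galAdicCompletionMap_eq_neg_of_ramified (hc : c ≠ 1) (w : PlacesOver E v) (hw : c • w.1 = w.1)
    (he : v.asIdeal.ramificationIdx' w.1.asIdeal ≠ 1) :
    ∃ α : (w.1.adicCompletion E)ˣ, galAdicCompletionMap (L := E) c hw α = -α ∧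
      (Valued.v (α : w.1.adicCompletion E) = 1 ∨ Valued.v (α : w.1.adicCompletion E) = WithZero.exp (-1 : ℤ)) := by
  haveI : Algebra.IsSeparable F E := inferInstance
  set P : w.1.adicCompletion E := toPlace v w (HeckeCharacter.uniformizer F v : v.adicCompletion F) with hPdef
  obtain ⟨hvP, hσP⟩ := valued_toPlace_uniformizer_of_ramified E c hc w hw he
  rw [← hPdef] at hvP hσP
  have hP0 : P ≠ 0 := by
    intro h; rw [h, map_zero] at hvP; exact WithZero.zero_ne_coe hvP
  -- an anti-fixed non-zero element
  obtain ⟨x, hx⟩ := exists_galAdicCompletionMap_ne F E c hc hw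
  set D : w.1.adicCompletion E := x - galAdicCompletionMap (L := E) c hw x with hDdef
  have hD0 : D ≠ 0 := sub_ne_zero.2 (Ne.symm hx)
  have hσD : galAdicCompletionMap (L := E) c hw D = -D := by
    rw [hDdef, map_sub, galAdicCompletionMap_galAdicCompletionMap_self F E c (algEquiv_mul_self_eq_one F hc) hw, neg_sub]
  have hvD0 : Valued.v D ≠ 0 := (Valuation.ne_zero_iff _).2 hD0
  -- normalise the valuation into `{exp 0, exp (−1)}`
  set n : ℤ := WithZero.log (Valued.v D) with hndef
  set q : ℤ := (n + 1) / 2 with hqdef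
  have hα0 : D * P ^ q ≠ 0 := mul_ne_zero hD0 (zpow_ne_zero _ hP0)
  have hvα : Valued.v (D * P ^ q) = WithZero.exp (n - 2 * q) := by
    rw [map_mul, map_zpow₀, hvP, ← WithZero.exp_log hvD0, ← hndef, ← WithZero.exp_zsmul, ← WithZero.exp_add]
    congr 1; simp only [smul_eq_mul]; ring
  refine ⟨Units.mk0 _ hα0, ?_, ?_⟩
  · rw [Units.val_mk0, map_mul, map_zpow₀, hσD, hσP, neg_mul]
  · rw [Units.val_mk0, hvα]
    -- `n + 1 = 2 q + r`, `r ∈ {0, 1}`, so `n − 2 q = r − 1 ∈ {−1, 0}`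
    rcases Int.emod_two_eq_zero_or_one (n + 1) with h0 | h1
    · right
      congr 1; omega
    · left
      rw [← WithZero.exp_zero]
      congr 1; omega

/-! ## §2 The CM row -/

/-- **THE CM ROW**: for a CM field `L` (`F = L⁺`, `c` = complex conjugation) and a place `w ∣ v` of `L` fixed by `c` and RAMIFIED over `L⁺` (ANY residue
characteristic), there is `α ∈ L_wˣ` with `c_w α = −α` which is a unit or a uniformiser. [cite: SerreLocalFields1979, Ch. IV §§1–2] [cite: Jacobowitz1962, §5, §9] -/
theorem exists_units_galAdicCompletionMap_complexConj_eq_neg_of_ramified (L : Type) [Field L] [NumberField L] [IsCMField L]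
    {v : HeightOneSpectrum (𝓞 ↥(maximalRealSubfield L))} (w : PlacesOver L v) (hw : IsCMField.complexConj L • w.1 = w.1)
    (he : v.asIdeal.ramificationIdx' w.1.asIdeal ≠ 1) :
    ∃ α : (w.1.adicCompletion L)ˣ, galAdicCompletionMap (L := L) (IsCMField.complexConj L) hw α = -α ∧
      (Valued.v (α : w.1.adicCompletion L) = 1 ∨ Valued.v (α : w.1.adicCompletion L) = WithZero.exp (-1 : ℤ)) :=
  exists_units_galAdicCompletionMap_eq_neg_of_ramified L (IsCMField.complexConj L) (IsCMField.complexConj_ne_one L) w hw he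

end Literature.NumberTheory.Automorphic.UnitaryGroup

end
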